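import Literature.Analysis.FluidPDE.QuasiSelfSimilarMoveSP03Slot
import Literature.Analysis.FluidPDE.QuasiSelfSimilarMoveSP04Slot
import HarnessLib

/-!
# Straight move: link between phases 3 and 4

Topic `Literature/Analysis/FluidPDE`. Emitted data / kernel certificates of the explicit straight generating
move (`S`) in the typed-chain model, under the contract of `PlanarGeneratorAssembly.lean`
(`acm_compatible_blocks_of_slots`). Generated by the author's emitter from the exact rational design;
no named facts, every theorem is decided in the kernel or assembled from decided chunks. [folklore]

## References

* G. Alberti, G. Crippa, A. L. Mazzucato, *Exponential self-similar mixing by incompressible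
  flows*, J. Amer. Math. Soc. 32 (2019), 445–490, §8 (arXiv:1605.02090).
-/

noncomputable section

namespace Literature.Analysis.FluidPDE.QuasiSelfSimilar.MoveS

open PlanarKinematics QuasiSelfSimilar

set_option maxHeartbeats 4000000 in
/-- Kernel check of the forward cover entries, nodes `0 ≤ k < 29`. [folklore] -/
theorem cov03_c0 : ∀ k, 0 ≤ k → k < 29 → PhaseQ.coverEntryB P03 true P04 false k (rc03.getD k (0, [])) = true := by decide +kernel
/-- Kernel check of the forward cover entries (all nodes). [folklore] -/
theorem cov03 : ∀ k < 29, PhaseQ.coverEntryB P03 true P04 false k (rc03.getD k (0, [])) = true :=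
  (forall_lt_of_chunk (forall_lt_zero fun k => PhaseQ.coverEntryB P03 true P04 false k (rc03.getD k (0, [])) = true) cov03_c0)
set_option maxHeartbeats 4000000 in
/-- Kernel check of the backward cover entries, nodes `0 ≤ k < 40`. [folklore] -/
theorem cov03'_c0 : ∀ k, 0 ≤ k → k < 40 → PhaseQ.coverEntryB P04 false P03 true k (rc03'.getD k (0, [])) = true := by decide +kernel
set_option maxHeartbeats 4000000 in
/-- Kernel check of the backward cover entries, nodes `40 ≤ k < 43`. [folklore] -/
theorem cov03'_c1 : ∀ k, 40 ≤ k → k < 43 → PhaseQ.coverEntryB P04 false P03 true k (rc03'.getD k (0, [])) = true := by decide +kernel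
/-- Kernel check of the backward cover entries (all nodes). [folklore] -/
theorem cov03' : ∀ k < 43, PhaseQ.coverEntryB P04 false P03 true k (rc03'.getD k (0, [])) = true :=
  (forall_lt_of_chunk (forall_lt_of_chunk (forall_lt_zero fun k => PhaseQ.coverEntryB P04 false P03 true k (rc03'.getD k (0, [])) = true) cov03'_c0) cov03'_c1)

/-- Re-description of the boundary between phases 3 and 4. [folklore] -/
theorem redesc03 : PhaseQ.redescribeB P03 true P04 false rc03 rc03' = true :=
  PhaseQ.redescribeB_of_forall (by decide +kernel) (by decide +kernel) (by decide +kernel) (by decide +kernel)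
    (by decide +kernel) (by decide +kernel) (by decide +kernel) (by rw [P03_K]; exact cov03) (by rw [P04_K]; exact cov03')

/-- Link test between slots 3 and 4. [folklore] -/
theorem link03 : Slot.linkB slot03 slot04 = true :=
  Slot.linkB_intro redesc03 (by decide +kernel) (by decide +kernel) (by decide +kernel)

end Literature.Analysis.FluidPDE.QuasiSelfSimilar.MoveS

end
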